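import Mathlib
import HarnessLib
import Literature.MathematicalPhysics.QuantumFieldTheory.LatticeGaugeProofs
import Summits.Ventures.LatticeQCDFlow.Exactness.KernelSymmetry
import Summits.Ventures.LatticeQCDFlow.Exactness.OpenBoundaryHMCForce
import Summits.Ventures.LatticeQCDFlow.Exactness.OpenBoundaryTranslation
import Summits.Ventures.LatticeQCDFlow.Scoring.SymmetricSamplerOddObservables

/-!
# The engine's `n`-step leapfrog HMC kernel commutes with every relabelling of the links its increment respects; the periodic arm commutes with all translations and the open-boundary arm with the translations orthogonal to the open direction — so its plaquette one-point function is a profile at EVERY step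

HONEST FRAMING: exact (Metropolis-corrected) sampling algorithms for lattice gauge theory;
figures of merit are autocorrelation/cost numbers at stated couplings and volumes; no
continuum-physics claim.

Venture `LatticeQCDFlow` (cell pub-lqcd), topic `Exactness`, FANOUT row 21 (`su3-base`, arms `E2 = PBC-HMC` and `OBC-HMC` AS
RUN: row 9's engine kernel `sunLeapfrogHMCN` — momentum refresh, `n` P-first leapfrog steps with the arm's own force, flip,
Metropolis test, forget — with row 21's `sunWilsonForce` / `sunWeightedForce (obcWeight τ)`).  NEW WORK of the cell over row
14's `KernelSymmetry` (`conjKernel_involMH_of_comm`, `conjKernel_refreshUpdate_eq_self`: a refresh–update–forget kernel whose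
phase-space kernel commutes with `Θ × R` commutes with `Θ`), row 9's `SUNMultiStepLeapfrogHMC` (`sunLeapfrogProposalN`,
`sunLeapfrogHMCN`, `sunMomentumLaw`), row 7's `TransformedKernel` (`conjKernel`), row 16's `SymmetricSamplerOddObservables`
(`map_bind_nHit_eq_self`), row 22's `configTranslate` (`PTBCWilsonDefect`), row 21's `SUNWilsonHMCForce` / `OpenBoundaryHMCForce` /
`OpenBoundaryTranslation` and the Literature (`plaquetteLoopSum_siteTranslate`, `withDensity_map_of_measurableEquiv`).
Row 21's `Scoring/HMCKernelTranslation` is the same statement for row 16's kernel `hmcKernel`; THIS file is for the engine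
kernel of the arms of record and covers the OPEN-BOUNDARY arm, which has no `Scoring`-side kernel.  Def-free; nothing is cited
as a fact; no number.

## What is here

* §1 `sunLeapfrogProposalN_comp_equiv` — for every relabelling `σ` of the links and every increment `g` with
  `g(U ∘ σ) = g(U) ∘ σ`, the `n`-step proposal satisfies `Ψ_n(U ∘ σ, p ∘ σ) = Ψ_n(U, p) ∘ σ` (kick, group drift and flip act link
  by link); `sunKinetic_comp_equiv`; `sunMomentumLaw_map_comp_equiv` (the momentum law is relabelling invariant);
  **`conjKernel_sunLeapfrogHMCN_of_equivariant`** — for any measurable bijections `Θ`, `R` acting as `U ↦ U ∘ σ`, `p ↦ p ∘ σ`,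
  an equivariant increment, a `σ`-invariant action and kinetic energy: `conjKernel (sunLeapfrogHMCN …) Θ = sunLeapfrogHMCN …`.
* §2 THE PERIODIC ARM: `configTranslate_eq_siteTranslate`, `sunWilsonForce_configTranslate` (the Wilson force travels with the
  links), **`conjKernel_wilsonForce_sunLeapfrogHMCN_configTranslate`** (every translation `v`, every `β`, `ε`, `nstep`, `L`).
* §3 THE OPEN-BOUNDARY ARM: `weightedLoopSum_configTranslate` (weights move with the translation), `sunWeightedForce_obc_configTranslate`
  (`v_τ = 0`: the open-boundary force travels with the links), **`conjKernel_obcForce_sunLeapfrogHMCN_configTranslate`** (every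
  translation with `v_τ = 0`).
* §4 AT EVERY STEP: the `N`-step laws from a translation-invariant start are translation invariant (`…_law_map_configTranslate`),
  cold (`U ≡ 1`) and hot (`∏ dHaar`) starts qualify; hence **`integral_obcHmcChain_plaquette_eq_of_apply_eq`** — along the
  open-boundary HMC run from the cold or hot start, at EVERY step the one-point function of any plaquette function depends on the
  base point only through its open coordinate (a PROFILE, as in equilibrium `OpenBoundaryProfile`), and
  `integral_wilsonHmcChain_plaquette_configTranslate` — along the periodic run it is homogeneous.
NOT CLAIMED: axis permutations / reflections of the engine kernel (same template, not instantiated here); stationarity; numbers.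
-/

noncomputable section

namespace Summit.Ventures.LatticeQCDFlow.Exactness

open MeasureTheory ProbabilityTheory ProbabilityTheory.Kernel Set Function
open Literature.MathematicalPhysics.QuantumFieldTheory
open scoped ENNReal Matrix

set_option backward.isDefEq.respectTransparency false

/-! ## §1 Relabelling the links -/

section Relabel

variable {n : Type*} [Fintype n] [DecidableEq n]
variable {E : Type*} [NormedAddCommGroup E] [NormedSpace ℝ E]
variable (ι : E →ₗ[ℝ] Matrix n n ℂ) (hι : ∀ a, (ι a)ᴴ = -ι a ∧ (ι a).trace = 0)
variable {Lk : Type*} (σ : Lk ≃ Lk) (ε : ℝ) {g : (Lk → Matrix.specialUnitaryGroup n ℂ) → Lk → E}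

/-- The group drift acts link by link: `e_ε(p ∘ σ) = e_ε(p) ∘ σ`. -/
theorem sunExpDrift_comp_equiv (p : Lk → E) : sunExpDrift ι hι ε (p ∘ σ) = sunExpDrift ι hι ε p ∘ σ := rfl

/-- **The `n`-step proposal commutes with every relabelling its increment respects**:
`Ψ_n(U ∘ σ, p ∘ σ) = ((Ψ_n(U, p)).1 ∘ σ, (Ψ_n(U, p)).2 ∘ σ)`. -/
theorem sunLeapfrogProposalN_comp_equiv (hgσ : ∀ U, g (U ∘ σ) = g U ∘ σ) (N : ℕ)
    (z : (Lk → Matrix.specialUnitaryGroup n ℂ) × (Lk → E)) :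
    sunLeapfrogProposalN ι hι ε g N (z.1 ∘ σ, z.2 ∘ σ) =
      ((sunLeapfrogProposalN ι hι ε g N z).1 ∘ σ, (sunLeapfrogProposalN ι hι ε g N z).2 ∘ σ) := by
  set Tσ : (Lk → Matrix.specialUnitaryGroup n ℂ) × (Lk → E) → (Lk → Matrix.specialUnitaryGroup n ℂ) × (Lk → E) :=
    fun z => (z.1 ∘ σ, z.2 ∘ σ) with hTσ
  have hkick : Function.Semiconj Tσ (⇑(kick g)) (⇑(kick g)) := by
    intro z
    simp only [hTσ, kick, Equiv.coe_fn_mk, hgσ]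
    rfl
  have hdrift : Function.Semiconj Tσ (⇑(drift (mulDrift (sunExpDrift ι hι ε)))) (⇑(drift (mulDrift (sunExpDrift ι hι ε)))) := by
    intro z
    simp only [hTσ, drift, mulDrift, Equiv.coe_fn_mk, Equiv.coe_mulLeft, sunExpDrift_comp_equiv]
    rfl
  have hflip : Function.Semiconj Tσ (⇑(flip : Equiv.Perm ((Lk → Matrix.specialUnitaryGroup n ℂ) × (Lk → E))))
      (⇑(flip : Equiv.Perm ((Lk → Matrix.specialUnitaryGroup n ℂ) × (Lk → E)))) := by
    intro z
    simp only [hTσ, flip_apply]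
    rfl
  have hword : Function.Semiconj Tσ (⇑(sunLeapfrogProposalN ι hι ε g N)) (⇑(sunLeapfrogProposalN ι hι ε g N)) := by
    unfold sunLeapfrogProposalN palindromicWord
    simp only [List.reverse_singleton, List.prod_singleton, Equiv.Perm.coe_mul, Equiv.Perm.coe_pow]
    exact hflip.comp_right (((hkick.comp_right hdrift).comp_right hkick).iterate_right N)
  exact (hword z).symm

variable (N : ℕ) [Fintype Lk]

variable [MeasurableSpace E] [BorelSpace E] (μ : Measure E) {T : (Lk → E) → ℝ}

omit [Fintype n] [DecidableEq n] [NormedAddCommGroup E] [NormedSpace ℝ E] [BorelSpace E] in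
/-- **The momentum law is relabelling invariant**: for a kinetic energy with `T(p ∘ σ) = T(p)` and any measurable bijection
`R` acting as `p ↦ p ∘ σ`, `R_* (Z⁻¹ e^{−T} μ^{⊗links}) = Z⁻¹ e^{−T} μ^{⊗links}`. -/
theorem sunMomentumLaw_map_comp_equiv [SigmaFinite μ] (hT : ∀ p, T (p ∘ σ) = T p) (R : (Lk → E) ≃ᵐ (Lk → E))
    (hR : ∀ p, R p = p ∘ σ) : (sunMomentumLaw (L := Lk) μ T).map R = sunMomentumLaw μ T := by
  unfold sunMomentumLaw sunMomentumWeight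
  rw [Measure.map_smul]
  congr 1
  have hpi : (Measure.pi fun _ : Lk => μ).map R = Measure.pi fun _ : Lk => μ := by
    have h := (measurePreserving_comp_equiv (G := E) σ μ).map_eq
    have hcoe : (⇑R : (Lk → E) → Lk → E) = fun p => p ∘ σ := funext hR
    rw [hcoe]
    exact h
  exact withDensity_map_of_measurableEquiv _ R _ hpi fun p => by rw [hR, hT]

variable [FiniteDimensional ℝ E] (hg : Measurable g)

/-- **THE ENGINE KERNEL COMMUTES WITH EVERY RELABELLING ITS DATA RESPECT.**  For measurable bijections `Θ` of the
configurations and `R` of the momenta acting as `U ↦ U ∘ σ`, `p ↦ p ∘ σ`, an increment with `g(U ∘ σ) = g(U) ∘ σ`, an action with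
`S(U ∘ σ) = S(U)` and a kinetic energy with `T(p ∘ σ) = T(p)` (both measurable):
`conjKernel (sunLeapfrogHMCN ι hι ε μ T hg S n) Θ = sunLeapfrogHMCN ι hι ε μ T hg S n`. -/
theorem conjKernel_sunLeapfrogHMCN_of_equivariant [SigmaFinite μ] {S : (Lk → Matrix.specialUnitaryGroup n ℂ) → ℝ}
    (hS : Measurable S) (hTm : Measurable T) (Θ : (Lk → Matrix.specialUnitaryGroup n ℂ) ≃ᵐ (Lk → Matrix.specialUnitaryGroup n ℂ))
    (hΘ : ∀ U, Θ U = U ∘ σ) (R : (Lk → E) ≃ᵐ (Lk → E)) (hR : ∀ p, R p = p ∘ σ) (hgσ : ∀ U, g (U ∘ σ) = g U ∘ σ)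
    (hSσ : ∀ U, S (U ∘ σ) = S U) (hTσ : ∀ p, T (p ∘ σ) = T p) :
    conjKernel (sunLeapfrogHMCN ι hι ε μ T hg S N) Θ = sunLeapfrogHMCN ι hι ε μ T hg S N := by
  unfold sunLeapfrogHMCN
  refine conjKernel_refreshUpdate_eq_self _ _ Θ R (sunMomentumLaw_map_comp_equiv σ μ hTσ R hR)
    (conjKernel_involMH_of_comm ((hS.comp measurable_fst).add (hTm.comp measurable_snd)) _ (fun z => ?_) (fun z => ?_))
  · show sunLeapfrogProposalN ι hι ε g N (Θ z.1, R z.2) = (Θ (sunLeapfrogProposalN ι hι ε g N z).1, R (sunLeapfrogProposalN ι hι ε g N z).2)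
    rw [hΘ, hR, hΘ, hR]
    exact sunLeapfrogProposalN_comp_equiv ι hι σ ε hgσ N z
  · show S (Θ z.1) + T (R z.2) = S z.1 + T z.2
    rw [hΘ, hR, hSσ, hTσ]

end Relabel

/-! ## §2 The periodic arm: the Wilson force travels with the links, the kernel commutes with every translation -/

section Periodic

variable (N : ℕ) {d L : ℕ} [NeZero L]

omit [NeZero L] in
/-- The two translation spellings agree: `configTranslate v U = U.siteTranslate v`. -/
theorem configTranslate_eq_siteTranslate {G : Type*} [MeasurableSpace G] (v : Site d L) (U : GaugeConfig d L G) :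
    configTranslate v U = U.siteTranslate v := by
  funext e
  rw [configTranslate_apply_edge, GaugeConfig.siteTranslate_apply, add_comm]

omit [NeZero L] in
/-- `configTranslate v U = U ∘ edgeTranslate v`, the relabelling form. -/
theorem configTranslate_eq_comp {G : Type*} [MeasurableSpace G] (v : Site d L) (U : GaugeConfig d L G) :
    configTranslate v U = U ∘ edgeTranslate v := rfl

omit [NeZero L] in
/-- **The Wilson force travels with the links**: `F(T_v U) = F(U) ∘ edgeTranslate v`. -/
theorem sunWilsonForce_configTranslate (β : ℝ) (v : Site d L) (U : GaugeConfig d L (Matrix.specialUnitaryGroup (Fin N) ℂ)) :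
    sunWilsonForce N β (U ∘ edgeTranslate v) = sunWilsonForce N β U ∘ edgeTranslate v := by
  funext e
  obtain ⟨x, μ⟩ := e
  rw [← configTranslate_eq_comp, configTranslate_eq_siteTranslate]
  simp only [Function.comp_apply, edgeTranslate_apply, sunWilsonForce, plaquetteLoopSum_siteTranslate, add_comm x v]

/-- The engine's kinetic energy does not see a relabelling of the links. -/
theorem sunKinetic_comp_equiv {Lk : Type*} [Fintype Lk] (σ : Lk ≃ Lk) (p : Lk → SUNCoords N) :
    sunKinetic N (p ∘ σ) = sunKinetic N p := by
  unfold sunKinetic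
  exact Fintype.sum_equiv σ _ _ fun _ => rfl

/-- **THE PERIODIC ARM AS RUN COMMUTES WITH EVERY LATTICE TRANSLATION**: for every `v`, `β`, `ε`, `nstep`, `L`,
`conjKernel K (T_v) = K` for the engine's `n`-step leapfrog HMC with its own Wilson force and the Metropolis test on `β S_W`. -/
theorem conjKernel_wilsonForce_sunLeapfrogHMCN_configTranslate (β ε : ℝ) (nstep : ℕ) (v : Site d L) :
    conjKernel (sunLeapfrogHMCN (sunCoordι N) (sunCoordι_skew N) ε (Measure.addHaar : Measure (SUNCoords N)) (sunKinetic N)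
        (measurable_halfKick_sun N (measurable_sunWilsonForce N (d := d) (L := L) β) ε)
        (fun U => β * wilsonAction (suRep N) U) nstep) (configTranslate v) =
      sunLeapfrogHMCN (sunCoordι N) (sunCoordι_skew N) ε (Measure.addHaar : Measure (SUNCoords N)) (sunKinetic N)
        (measurable_halfKick_sun N (measurable_sunWilsonForce N (d := d) (L := L) β) ε)
        (fun U => β * wilsonAction (suRep N) U) nstep :=
  conjKernel_sunLeapfrogHMCN_of_equivariant (sunCoordι N) (sunCoordι_skew N) (edgeTranslate v) ε nstep Measure.addHaar
    (measurable_halfKick_sun N (measurable_sunWilsonForce N β) ε)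
    ((continuous_smul_wilsonAction (suRep N) continuous_suRep β).measurable) (measurable_sunKinetic N)
    (configTranslate v) (fun U => rfl) (configTranslate (G := SUNCoords N) v) (fun p => rfl)
    (fun U => by rw [sunWilsonForce_configTranslate]; rfl)
    (fun U => by rw [← configTranslate_eq_comp, wilsonAction_configTranslate])
    (fun p => sunKinetic_comp_equiv N (edgeTranslate v) p)

end Periodic

/-! ## §3 The open-boundary arm: the weighted force travels with the links under translations orthogonal to `τ` -/

section OpenBoundary

variable (N : ℕ) {d L : ℕ} [NeZero L]

omit [NeZero L] in
/-- **Translating the configuration moves the weights of the loop sum**: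
`Ω^w_{x,μ}(T_v V) = Ω^{w(−v+·)}_{v+x,μ}(V)`. -/
theorem weightedLoopSum_configTranslate (w : Plaquette d L → ℝ) (v : Site d L)
    (V : GaugeConfig d L (Matrix.specialUnitaryGroup (Fin N) ℂ)) (x : Site d L) (μ : Fin d) :
    weightedLoopSum w (configTranslate v V) x μ = weightedLoopSum (fun q : Plaquette d L => w (-v + q.1, q.2)) V (v + x) μ := by
  unfold weightedLoopSum
  refine Finset.sum_congr rfl fun ν _ => ?_
  split_ifs with h
  · rfl
  · have hw1 : plaqWeight w x μ ν = plaqWeight (fun q : Plaquette d L => w (-v + q.1, q.2)) (v + x) μ ν := by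
      unfold plaqWeight; simp only [neg_add_cancel_left]
    have hw2 : plaqWeight w (x - Pi.single ν 1) μ ν =
        plaqWeight (fun q : Plaquette d L => w (-v + q.1, q.2)) (v + x - Pi.single ν 1) μ ν := by
      unfold plaqWeight; simp only [add_sub_assoc, neg_add_cancel_left]
    rw [hw1, hw2, plaquetteHolonomy_configTranslate, plaquetteHolonomy_configTranslate, configTranslate_apply_edge,
      add_sub_assoc]

omit [NeZero L] in
/-- For `v_τ = 0` the open-boundary weights do not move: `Ω^{obc}_{x,μ}(T_v V) = Ω^{obc}_{v+x,μ}(V)`. -/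
theorem weightedLoopSum_obc_configTranslate {τ : Fin d} {v : Site d L} (hv : v τ = 0)
    (V : GaugeConfig d L (Matrix.specialUnitaryGroup (Fin N) ℂ)) (x : Site d L) (μ : Fin d) :
    weightedLoopSum (obcWeight τ) (configTranslate v V) x μ = weightedLoopSum (obcWeight τ) V (v + x) μ := by
  rw [weightedLoopSum_configTranslate]
  congr 1
  funext q
  exact obcWeight_translate (τ := τ) (v := v) hv q

omit [NeZero L] in
/-- **The open-boundary force travels with the links** under translations with `v_τ = 0`:
`F^{obc}(T_v U) = F^{obc}(U) ∘ edgeTranslate v`. -/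
theorem sunWeightedForce_obc_configTranslate {τ : Fin d} {v : Site d L} (hv : v τ = 0) (β : ℝ)
    (U : GaugeConfig d L (Matrix.specialUnitaryGroup (Fin N) ℂ)) :
    sunWeightedForce N (obcWeight τ) β (U ∘ edgeTranslate v) = sunWeightedForce N (obcWeight τ) β U ∘ edgeTranslate v := by
  funext e
  obtain ⟨x, μ⟩ := e
  rw [← configTranslate_eq_comp]
  simp only [Function.comp_apply, edgeTranslate_apply, sunWeightedForce, weightedLoopSum_obc_configTranslate N hv]

/-- **THE OPEN-BOUNDARY ARM AS RUN COMMUTES WITH EVERY TRANSLATION ORTHOGONAL TO THE OPEN DIRECTION**: for `v_τ = 0`,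
every `β`, `ε`, `nstep`, `L`, `conjKernel K (T_v) = K` for the engine's `n`-step leapfrog HMC with its own open-boundary force and
the Metropolis test on `β S_OBC`. -/
theorem conjKernel_obcForce_sunLeapfrogHMCN_configTranslate (τ : Fin d) (β ε : ℝ) (nstep : ℕ) {v : Site d L}
    (hv : v τ = 0) :
    conjKernel (sunLeapfrogHMCN (sunCoordι N) (sunCoordι_skew N) ε (Measure.addHaar : Measure (SUNCoords N)) (sunKinetic N)
        (measurable_halfKick_sun N (measurable_sunWeightedForce N (d := d) (L := L) (obcWeight τ) β) ε)
        (fun U => β * obcAction (suRep N) τ U) nstep) (configTranslate v) =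
      sunLeapfrogHMCN (sunCoordι N) (sunCoordι_skew N) ε (Measure.addHaar : Measure (SUNCoords N)) (sunKinetic N)
        (measurable_halfKick_sun N (measurable_sunWeightedForce N (d := d) (L := L) (obcWeight τ) β) ε)
        (fun U => β * obcAction (suRep N) τ U) nstep :=
  conjKernel_sunLeapfrogHMCN_of_equivariant (sunCoordι N) (sunCoordι_skew N) (edgeTranslate v) ε nstep Measure.addHaar
    (measurable_halfKick_sun N (measurable_sunWeightedForce N (obcWeight τ) β) ε)
    ((continuous_obcAction (suRep N) continuous_suRep τ).measurable.const_mul β) (measurable_sunKinetic N)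
    (configTranslate v) (fun U => rfl) (configTranslate (G := SUNCoords N) v) (fun p => rfl)
    (fun U => by rw [sunWeightedForce_obc_configTranslate N hv]; rfl)
    (fun U => by rw [← configTranslate_eq_comp, obcAction_configTranslate (suRep N) hv])
    (fun p => sunKinetic_comp_equiv N (edgeTranslate v) p)

end OpenBoundary

/-! ## §4 At every step: translation-invariant laws along the runs; the open-boundary plaquette profile at every step -/

section Chains

variable (N : ℕ) {d L : ℕ} [NeZero L]

omit [NeZero L] in
/-- The cold start `U ≡ 1` is invariant under every translation. -/
theorem dirac_one_map_configTranslate (v : Site d L) :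
    (Measure.dirac (1 : GaugeConfig d L (Matrix.specialUnitaryGroup (Fin N) ℂ))).map (configTranslate v) = Measure.dirac 1 := by
  rw [Measure.map_dirac' (configTranslate v).measurable]
  rfl

/-- The hot start `∏ dHaar` is invariant under every translation. -/
theorem piHaar_map_configTranslate (v : Site d L) :
    (Measure.pi fun _ : Edge d L => haarProbability (Matrix.specialUnitaryGroup (Fin N) ℂ)).map (configTranslate v) =
      Measure.pi fun _ : Edge d L => haarProbability (Matrix.specialUnitaryGroup (Fin N) ℂ) :=
  (measurePreserving_configTranslate v (haarProbability (Matrix.specialUnitaryGroup (Fin N) ℂ))).map_eq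

/-- **Periodic arm: the `t`-step law from a translation-invariant start is translation invariant.** -/
theorem wilsonHmcChain_law_map_configTranslate (β ε : ℝ) (nstep : ℕ) (v : Site d L)
    {μ₀ : Measure (GaugeConfig d L (Matrix.specialUnitaryGroup (Fin N) ℂ))} (hμ₀ : μ₀.map (configTranslate v) = μ₀) (t : ℕ) :
    (μ₀.bind (nHit (sunLeapfrogHMCN (sunCoordι N) (sunCoordι_skew N) ε (Measure.addHaar : Measure (SUNCoords N)) (sunKinetic N)
        (measurable_halfKick_sun N (measurable_sunWilsonForce N (d := d) (L := L) β) ε)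
        (fun U => β * wilsonAction (suRep N) U) nstep) t)).map (configTranslate v) =
      μ₀.bind (nHit (sunLeapfrogHMCN (sunCoordι N) (sunCoordι_skew N) ε (Measure.addHaar : Measure (SUNCoords N)) (sunKinetic N)
        (measurable_halfKick_sun N (measurable_sunWilsonForce N (d := d) (L := L) β) ε)
        (fun U => β * wilsonAction (suRep N) U) nstep) t) :=
  Scoring.map_bind_nHit_eq_self (conjKernel_wilsonForce_sunLeapfrogHMCN_configTranslate N β ε nstep v) hμ₀ t

/-- **Open-boundary arm: the `t`-step law from a start invariant under `T_v` (`v_τ = 0`) is invariant under `T_v`.** -/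
theorem obcHmcChain_law_map_configTranslate (τ : Fin d) (β ε : ℝ) (nstep : ℕ) {v : Site d L} (hv : v τ = 0)
    {μ₀ : Measure (GaugeConfig d L (Matrix.specialUnitaryGroup (Fin N) ℂ))} (hμ₀ : μ₀.map (configTranslate v) = μ₀) (t : ℕ) :
    (μ₀.bind (nHit (sunLeapfrogHMCN (sunCoordι N) (sunCoordι_skew N) ε (Measure.addHaar : Measure (SUNCoords N)) (sunKinetic N)
        (measurable_halfKick_sun N (measurable_sunWeightedForce N (d := d) (L := L) (obcWeight τ) β) ε)
        (fun U => β * obcAction (suRep N) τ U) nstep) t)).map (configTranslate v) =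
      μ₀.bind (nHit (sunLeapfrogHMCN (sunCoordι N) (sunCoordι_skew N) ε (Measure.addHaar : Measure (SUNCoords N)) (sunKinetic N)
        (measurable_halfKick_sun N (measurable_sunWeightedForce N (d := d) (L := L) (obcWeight τ) β) ε)
        (fun U => β * obcAction (suRep N) τ U) nstep) t) :=
  Scoring.map_bind_nHit_eq_self (conjKernel_obcForce_sunLeapfrogHMCN_configTranslate N τ β ε nstep hv) hμ₀ t

/-- **THE OPEN-BOUNDARY RUN'S PLAQUETTE ONE-POINT FUNCTION IS A PROFILE IN THE OPEN COORDINATE AT EVERY STEP**: from any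
start invariant under the translations orthogonal to `τ` (cold and hot starts are), at every step `t`, for every function `φ`
of one holonomy and every orientation, `E_t[φ(U_{x;ij})] = E_t[φ(U_{y;ij})]` whenever `x_τ = y_τ`. -/
theorem integral_obcHmcChain_plaquette_eq_of_apply_eq (τ : Fin d) (β ε : ℝ) (nstep : ℕ)
    {μ₀ : Measure (GaugeConfig d L (Matrix.specialUnitaryGroup (Fin N) ℂ))}
    (hμ₀ : ∀ v : Site d L, v τ = 0 → μ₀.map (configTranslate v) = μ₀) (t : ℕ) {F : Type*} [NormedAddCommGroup F]
    [NormedSpace ℝ F] (φ : Matrix.specialUnitaryGroup (Fin N) ℂ → F) (i j : Fin d) {x y : Site d L} (hxy : x τ = y τ) :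
    ∫ U, φ (plaquetteHolonomy U x i j) ∂(μ₀.bind (nHit (sunLeapfrogHMCN (sunCoordι N) (sunCoordι_skew N) ε
        (Measure.addHaar : Measure (SUNCoords N)) (sunKinetic N)
        (measurable_halfKick_sun N (measurable_sunWeightedForce N (d := d) (L := L) (obcWeight τ) β) ε)
        (fun U => β * obcAction (suRep N) τ U) nstep) t)) =
      ∫ U, φ (plaquetteHolonomy U y i j) ∂(μ₀.bind (nHit (sunLeapfrogHMCN (sunCoordι N) (sunCoordι_skew N) ε
        (Measure.addHaar : Measure (SUNCoords N)) (sunKinetic N)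
        (measurable_halfKick_sun N (measurable_sunWeightedForce N (d := d) (L := L) (obcWeight τ) β) ε)
        (fun U => β * obcAction (suRep N) τ U) nstep) t)) := by
  have hv : (y - x) τ = 0 := by rw [Pi.sub_apply, hxy, sub_self]
  have h := (MeasurePreserving.mk (configTranslate (y - x)).measurable
    (obcHmcChain_law_map_configTranslate N τ β ε nstep hv (hμ₀ _ hv) t)).integral_comp'
    (fun U => φ (plaquetteHolonomy U x i j))
  simp only [plaquetteHolonomy_configTranslate, sub_add_cancel] at h
  exact h.symm

/-- Cold start of the open-boundary run: the plaquette one-point function is a profile at every step. -/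
theorem integral_obcHmcColdStart_plaquette_eq_of_apply_eq (τ : Fin d) (β ε : ℝ) (nstep t : ℕ) {F : Type*}
    [NormedAddCommGroup F] [NormedSpace ℝ F] (φ : Matrix.specialUnitaryGroup (Fin N) ℂ → F) (i j : Fin d) {x y : Site d L}
    (hxy : x τ = y τ) :
    ∫ U, φ (plaquetteHolonomy U x i j) ∂((Measure.dirac (1 : GaugeConfig d L (Matrix.specialUnitaryGroup (Fin N) ℂ))).bind
        (nHit (sunLeapfrogHMCN (sunCoordι N) (sunCoordι_skew N) ε (Measure.addHaar : Measure (SUNCoords N)) (sunKinetic N)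
        (measurable_halfKick_sun N (measurable_sunWeightedForce N (d := d) (L := L) (obcWeight τ) β) ε)
        (fun U => β * obcAction (suRep N) τ U) nstep) t)) =
      ∫ U, φ (plaquetteHolonomy U y i j) ∂((Measure.dirac (1 : GaugeConfig d L (Matrix.specialUnitaryGroup (Fin N) ℂ))).bind
        (nHit (sunLeapfrogHMCN (sunCoordι N) (sunCoordι_skew N) ε (Measure.addHaar : Measure (SUNCoords N)) (sunKinetic N)
        (measurable_halfKick_sun N (measurable_sunWeightedForce N (d := d) (L := L) (obcWeight τ) β) ε)
        (fun U => β * obcAction (suRep N) τ U) nstep) t)) :=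
  integral_obcHmcChain_plaquette_eq_of_apply_eq N τ β ε nstep (fun v _ => dirac_one_map_configTranslate N v) t φ i j hxy

/-- Hot start of the open-boundary run: the plaquette one-point function is a profile at every step. -/
theorem integral_obcHmcHotStart_plaquette_eq_of_apply_eq (τ : Fin d) (β ε : ℝ) (nstep t : ℕ) {F : Type*}
    [NormedAddCommGroup F] [NormedSpace ℝ F] (φ : Matrix.specialUnitaryGroup (Fin N) ℂ → F) (i j : Fin d) {x y : Site d L}
    (hxy : x τ = y τ) :
    ∫ U, φ (plaquetteHolonomy U x i j) ∂((Measure.pi fun _ : Edge d L => haarProbability (Matrix.specialUnitaryGroup (Fin N) ℂ)).bind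
        (nHit (sunLeapfrogHMCN (sunCoordι N) (sunCoordι_skew N) ε (Measure.addHaar : Measure (SUNCoords N)) (sunKinetic N)
        (measurable_halfKick_sun N (measurable_sunWeightedForce N (d := d) (L := L) (obcWeight τ) β) ε)
        (fun U => β * obcAction (suRep N) τ U) nstep) t)) =
      ∫ U, φ (plaquetteHolonomy U y i j) ∂((Measure.pi fun _ : Edge d L => haarProbability (Matrix.specialUnitaryGroup (Fin N) ℂ)).bind
        (nHit (sunLeapfrogHMCN (sunCoordι N) (sunCoordι_skew N) ε (Measure.addHaar : Measure (SUNCoords N)) (sunKinetic N)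
        (measurable_halfKick_sun N (measurable_sunWeightedForce N (d := d) (L := L) (obcWeight τ) β) ε)
        (fun U => β * obcAction (suRep N) τ U) nstep) t)) :=
  integral_obcHmcChain_plaquette_eq_of_apply_eq N τ β ε nstep (fun v _ => piHaar_map_configTranslate N v) t φ i j hxy

/-- **Periodic run: plaquette one-point functions are homogeneous at every step** from any translation-invariant start:
`E_t[φ(U_{x;ij})] = E_t[φ(U_{v+x;ij})]` for every `v`. -/
theorem integral_wilsonHmcChain_plaquette_configTranslate (β ε : ℝ) (nstep : ℕ)
    {μ₀ : Measure (GaugeConfig d L (Matrix.specialUnitaryGroup (Fin N) ℂ))} (hμ₀ : ∀ v : Site d L, μ₀.map (configTranslate v) = μ₀)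
    (t : ℕ) {F : Type*} [NormedAddCommGroup F] [NormedSpace ℝ F] (φ : Matrix.specialUnitaryGroup (Fin N) ℂ → F) (i j : Fin d)
    (v x : Site d L) :
    ∫ U, φ (plaquetteHolonomy U x i j) ∂(μ₀.bind (nHit (sunLeapfrogHMCN (sunCoordι N) (sunCoordι_skew N) ε
        (Measure.addHaar : Measure (SUNCoords N)) (sunKinetic N)
        (measurable_halfKick_sun N (measurable_sunWilsonForce N (d := d) (L := L) β) ε)
        (fun U => β * wilsonAction (suRep N) U) nstep) t)) =
      ∫ U, φ (plaquetteHolonomy U (v + x) i j) ∂(μ₀.bind (nHit (sunLeapfrogHMCN (sunCoordι N) (sunCoordι_skew N) ε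
        (Measure.addHaar : Measure (SUNCoords N)) (sunKinetic N)
        (measurable_halfKick_sun N (measurable_sunWilsonForce N (d := d) (L := L) β) ε)
        (fun U => β * wilsonAction (suRep N) U) nstep) t)) := by
  have h := (MeasurePreserving.mk (configTranslate v).measurable
    (wilsonHmcChain_law_map_configTranslate N β ε nstep v (hμ₀ v) t)).integral_comp' (fun U => φ (plaquetteHolonomy U x i j))
  simp only [plaquetteHolonomy_configTranslate] at h
  exact h.symm

end Chains

end Summit.Ventures.LatticeQCDFlow.Exactness
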